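import Mathlib
import HarnessLib
import Literature.Computability.AlgebraicComplexity.PatternExpressions
import Summits.ValiantsHypothesis.ValiantsHypothesis.Theorems.MonotoneRestorationOrbitCompressionQPPinnedEntryRow

/-!
# Route MonotoneRestoration — aside `OrbitCompressionQP` (stmt-ValiantsHypothesis-18332), line
# `expression_compression`: the PUNCTURED-ROW pinned-entry gadget and the 2-row stratum for ALL
# second-row-affine inner polynomials (canonical form)

`…PinnedEntryRow` proves the 2-row stratum for `g(r, s) = Σ_b s_b H(r_b; r)` with `H(t; r)` symmetric in the
FULL row.  The canonical data of a column-symmetric `g` affine in the second row is instead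
`g(r, s) = g₀(r) + Σ_b s_b F(r_b; r_{-b})` with `F(t; z_1, …, z_m) = ∂g/∂s_b` symmetric in the PUNCTURED row
(`m + 1 = n`).  This file proves the gadget and the stratum directly in that form — no conversion, no division:
the Newton substituends are built from the punctured power sums `Σ_v x_{ρ0 v}^b − x_{ρ0 γ0}^b`.

* `exists_puncturedPowerSum` — `Σ_{j} x_{ρ0, succAbove(γ0) j}^b` as a `(1,1)`-expression;
* ★★ `exists_puncturedEntryRowGadget` — for a `VQP` family `F_m ∈ ℂ[t, z_1..z_m]` symmetric in `z` there are
  `(1,1)`-expressions `W_m` with `|W_m| ≤ 2^{(log₂(m+1) + c)^c}` and, on the `(m+1) × (m+1)` matrix,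
  `W_m.value ρ γ = F_m(x_{ρ0,γ0}; (x_{ρ0, succAbove(γ0) j})_j)`;
* ★ `narrowQP_twoRow_affine` — for every such `F`: `f_{m+1} = Σ_i Σ_b (Σ_{i'} x_{i'b}) · F_m(x_{ib}; row i ∖ b)`,
  i.e. `Σ_{i,i'} g(row i, row i')` for `g(r,s) = Σ_b s_b F(r_b; r_{-b})` — the generic second-row-affine
  column-symmetric inner polynomial up to its one-row part — is NQP (`(2,1)` labels).

Helper file (`--supports stmt-ValiantsHypothesis-18332`); def-free; nothing here is a named fact (Bläser–Jindal is
the tree's proved `BlaserJindal2019_thm4_holds`); no registered stub is closed; VP ≠ VNP is not moved.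
-/

noncomputable section

open MvPolynomial

-- `Summit.ValiantsHypothesis.ValiantsHypothesis.…` is the tree's single-conjunct layout (Sub = Summit).
set_option linter.dupNamespace false

namespace Summit.ValiantsHypothesis.ValiantsHypothesis.Theorems

namespace FormulaSubstitution

open Literature.Computability.AlgebraicComplexity

/-- **Punctured power sums**: `Σ_j x_{ρ0, succAbove(γ0) j}^b = Σ_v x_{ρ0 v}^b − x_{ρ0 γ0}^b` as a
`(1,1)`-expression of length `4b + 6`. [folklore] -/
theorem exists_puncturedPowerSum (m b : ℕ) :
    ∃ q : PatternExpr ℂ 1 1, q.length = 4 * b + 6 ∧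
      ∀ (ρ γ : Fin 1 → Fin (m + 1)), q.value (m + 1) ρ γ =
        ∑ j : Fin m, (X (ρ 0, (γ 0).succAbove j) : MvPolynomial (Fin (m + 1) × Fin (m + 1)) ℂ) ^ b := by
  obtain ⟨p, hpl, hpv⟩ := exists_edge_pow (F := ℂ) (k := 1) (l := 1) 0 0 b
  refine ⟨PatternExpr.add (PatternExpr.sumCol 0 p) (PatternExpr.mul (PatternExpr.const (-1)) p),
    by simp [PatternExpr.length, hpl]; ring, fun ρ γ => ?_⟩
  simp only [PatternExpr.value_add, PatternExpr.value_sumCol, PatternExpr.value_mul, PatternExpr.value_const,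
    hpv, Function.update_self]
  rw [Fin.sum_univ_succAbove (fun v => (X (ρ 0, v) : MvPolynomial (Fin (m + 1) × Fin (m + 1)) ℂ) ^ b) (γ 0)]
  simp only [map_neg, map_one]
  ring

/-- ★★ **Punctured-row pinned-entry gadget.**  For a `VQP` family `F_m ∈ ℂ[t, z_1, …, z_m]` (variables
`Option (Fin m)`) symmetric in `z`, there are `(1,1)`-label pattern expressions of quasi-polynomial length in
`m + 1` whose value on the `(m+1) × (m+1)` matrix at `(ρ, γ)` is `F_m(x_{ρ0,γ0}; (x_{ρ0, succAbove(γ0) j})_j)` —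
the pinned entry and the rest of the pinned row. [cite: BlaserJindal2019, Thm. 4] -/
theorem exists_puncturedEntryRowGadget (F : (m : ℕ) → MvPolynomial (Option (Fin m)) ℂ)
    (hsymm : ∀ (m : ℕ) (τ : Equiv.Perm (Fin m)), rename (Option.map τ) (F m) = F m)
    (hF : IsVQPFamily F) :
    ∃ c : ℕ, ∀ m : ℕ, ∃ W : PatternExpr ℂ 1 1,
      W.length ≤ 2 ^ ((Nat.log 2 (m + 1) + c) ^ c) ∧
      ∀ (ρ γ : Fin 1 → Fin (m + 1)), W.value (m + 1) ρ γ =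
        aeval (fun o : Option (Fin m) => o.elim (X (ρ 0, γ 0))
          (fun j => (X (ρ 0, (γ 0).succAbove j) : MvPolynomial (Fin (m + 1) × Fin (m + 1)) ℂ))) (F m) := by
  classical
  -- degrees
  set D : ℕ → ℕ := fun m => (F m).totalDegree with hDdef
  have hDt : ∀ m, (F m).degreeOf none ≤ D m := fun m => CoefficientSlices.degreeOf_none_le_totalDegree _
  have hDp : IsPBounded D := hF.1.2
  -- slices and cores
  choose P hP using fun m => exists_sliceCores (F m) (hsymm m)
  obtain ⟨cBJ, hBJ⟩ := exists_complexity_sliceCore_le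
  have hPc : ∀ m d, d ≤ D m → complexity (P m d) ≤
      ((D m + 1) * (complexity (F m) + 2) + 1 + D m + m + 2) ^ cBJ :=
    fun m d hd => hBJ m (F m) (P m d) (D m) d (hDt m) hd (hP m d)
  have hPd : ∀ m d, (P m d).totalDegree ≤ D m := fun m d => totalDegree_sliceCore_le (F m) (P m d) d (hP m d)
  -- the packaged family `Q_m = Σ_d w_d · P_{m,d}(y)`
  set Q : (m : ℕ) → MvPolynomial (Fin m ⊕ Fin (D m + 1)) ℂ := fun m =>
    ∑ d : Fin (D m + 1), X (Sum.inr d) * rename Sum.inl (P m d.val) with hQdef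
  have hQ : IsVQPFamily Q := by
    refine ⟨⟨?_, ?_⟩, ?_⟩
    · have h : IsPBounded fun m => m + (D m + 1) :=
        IsPBounded.add_holds IsPBounded.id (IsPBounded.add_holds hDp (IsPBounded.const 1))
      refine h.mono fun m => ?_
      simp [Fintype.card_sum, Fintype.card_fin]
    · have h : IsPBounded fun m => D m + 1 := IsPBounded.add_holds hDp (IsPBounded.const 1)
      refine h.mono fun m => ?_
      refine (totalDegree_finsetSum _ _).trans (Finset.sup_le fun d _ => ?_)
      calc (X (Sum.inr d) * rename Sum.inl (P m d.val) : MvPolynomial (Fin m ⊕ Fin (D m + 1)) ℂ).totalDegree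
          ≤ (X (Sum.inr d) : MvPolynomial (Fin m ⊕ Fin (D m + 1)) ℂ).totalDegree +
              (rename Sum.inl (P m d.val) : MvPolynomial (Fin m ⊕ Fin (D m + 1)) ℂ).totalDegree :=
            totalDegree_mul _ _
        _ ≤ 1 + D m := by
            refine Nat.add_le_add ?_ ((totalDegree_rename_le _ _).trans (hPd m d.val))
            rw [totalDegree_X]
        _ = D m + 1 := by omega
    · have hDq : IsQPBounded D := hDp.isQPBounded
      have hD1 : IsQPBounded fun m => D m + 1 := hDq.add (IsQPBounded.const 1)
      have hL : IsQPBounded fun m => complexity (F m) := hF.2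
      have hInner : IsQPBounded fun m => (D m + 1) * (complexity (F m) + 2) + 1 + D m + m + 2 :=
        ((((hD1.mul (hL.add (IsQPBounded.const 2))).add (IsQPBounded.const 1)).add hDq).add
          (IsPBounded.id.isQPBounded)).add (IsQPBounded.const 2)
      have hβ : IsQPBounded fun m =>
          (D m + 1) * (((D m + 1) * (complexity (F m) + 2) + 1 + D m + m + 2) ^ cBJ + 2) :=
        hD1.mul ((hInner.pow cBJ).add (IsQPBounded.const 2))
      refine hβ.mono fun m => ?_
      have hsum := complexity_finset_sum_le (Finset.univ : Finset (Fin (D m + 1)))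
        (fun d => (X (Sum.inr d) * rename Sum.inl (P m d.val) : MvPolynomial (Fin m ⊕ Fin (D m + 1)) ℂ))
      rw [Finset.card_univ, Fintype.card_fin] at hsum
      have hterm : ∀ d : Fin (D m + 1),
          complexity (X (Sum.inr d) * rename Sum.inl (P m d.val) : MvPolynomial (Fin m ⊕ Fin (D m + 1)) ℂ) ≤
            ((D m + 1) * (complexity (F m) + 2) + 1 + D m + m + 2) ^ cBJ + 1 := by
        intro d
        refine (complexity_mul_le_holds _ _).trans ?_
        rw [complexity_X_holds]
        have h1 := complexity_rename_le_holds' (Sum.inl : Fin m → Fin m ⊕ Fin (D m + 1)) (P m d.val)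
        have h2 := hPc m d.val (by have := d.isLt; omega)
        omega
      have hsum' : ∑ d : Fin (D m + 1),
          complexity (X (Sum.inr d) * rename Sum.inl (P m d.val) : MvPolynomial (Fin m ⊕ Fin (D m + 1)) ℂ) ≤
            (D m + 1) * (((D m + 1) * (complexity (F m) + 2) + 1 + D m + m + 2) ^ cBJ + 1) := by
        calc _ ≤ ∑ _d : Fin (D m + 1), (((D m + 1) * (complexity (F m) + 2) + 1 + D m + m + 2) ^ cBJ + 1) :=
              Finset.sum_le_sum fun d _ => hterm d
          _ = _ := by rw [Finset.sum_const, Finset.card_univ, Fintype.card_fin, smul_eq_mul]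
      show complexity (Q m) ≤ _
      calc complexity (Q m) ≤ _ := hsum
        _ ≤ (D m + 1) * (((D m + 1) * (complexity (F m) + 2) + 1 + D m + m + 2) ^ cBJ + 1) + (D m + 1) :=
            Nat.add_le_add_right hsum' _
        _ = (D m + 1) * (((D m + 1) * (complexity (F m) + 2) + 1 + D m + m + 2) ^ cBJ + 2) := by ring
  -- substituends on the `(m+1) × (m+1)` matrix: punctured Newton substituends for `y_j`, powers of the
  -- pinned entry for `w_d`
  have hsub : ∀ m : ℕ, ∃ E : ℕ → PatternExpr ℂ 1 1, ∀ j : ℕ, j ≤ m →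
      (E j).length ≤ (2 * (m + 1) + 2) ^ (Nat.log 2 m + 1) * ((m * (10 + 1) + 2) + 2 + (m + 1) + 1) ∧
      ∀ (ρ γ : Fin 1 → Fin (m + 1)), (E j).value (m + 1) ρ γ =
        aeval (fun i : Fin m => (X (ρ 0, (γ 0).succAbove i) : MvPolynomial (Fin (m + 1) × Fin (m + 1)) ℂ))
          (esymm (Fin m) ℂ j) := by
    intro m
    choose pw hpwl hpwv using fun b : ℕ => exists_puncturedPowerSum m b
    rcases Nat.eq_zero_or_pos m with hm | hm
    · -- `m = 0`: no variables to substitute; only `j = 0` is asked for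
      subst hm
      refine ⟨fun _ => PatternExpr.const 1, fun j hj => ⟨by simp [PatternExpr.length], fun ρ γ => ?_⟩⟩
      have hj0 : j = 0 := by omega
      subst hj0
      simp [esymm_zero]
    · obtain ⟨E, hE⟩ := exists_esymm_subst (ι := Fin m) (k := 1) (l := 1) (m + 1) m (m * (10 + 1) + 2)
        (fun i ρ γ => (X (ρ 0, (γ 0).succAbove i) : MvPolynomial (Fin (m + 1) × Fin (m + 1)) ℂ)) pw
        fun b hb => ⟨by rw [hpwl]; nlinarith, fun ρ γ => hpwv b ρ γ⟩
      exact ⟨E, fun j hj => hE j hj⟩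
  choose E hE using hsub
  choose Epw hEpwl hEpwv using fun d : ℕ => exists_edge_pow (F := ℂ) (k := 1) (l := 1) 0 0 d
  set θ : (m : ℕ) → Fin m ⊕ Fin (D m + 1) → PatternExpr ℂ 1 1 := fun m =>
    Sum.elim (fun j => E m (j.val + 1)) (fun d => Epw d.val) with hθdef
  -- lengths, quasi-polynomial in the family index `m`
  have hθ : ∃ b : ℕ, ∀ m : ℕ, ∀ i, (θ m i).length ≤ 2 ^ ((Nat.log 2 m + b) ^ b) := by
    obtain ⟨c₁, hc₁⟩ := gadget_esymm_length_qp 2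
    obtain ⟨a, ha⟩ := hDp
    obtain ⟨c₂, hc₂⟩ := NarrowClosure.qp_combine (a + 1) 0
    refine ⟨max c₁ c₂, fun m i => ?_⟩
    rcases i with j | d
    · have hm : 1 ≤ m := by have := j.isLt; omega
      have h1 := (hE m (j.val + 1) (by have := j.isLt; omega)).1
      have h10 : (10 : ℕ) ≤ 2 ^ ((Nat.log 2 m + 2) ^ 2) := by
        have : 2 ^ 2 ≤ (Nat.log 2 m + 2) ^ 2 := Nat.pow_le_pow_left (by omega) 2
        calc (10 : ℕ) ≤ 2 ^ (2 ^ 2) := by norm_num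
          _ ≤ 2 ^ ((Nat.log 2 m + 2) ^ 2) := Nat.pow_le_pow_right (by norm_num) this
      have h2 := hc₁ m 10 hm h10
      calc (θ m (Sum.inl j)).length = (E m (j.val + 1)).length := rfl
        _ ≤ _ := h1
        _ ≤ 2 ^ ((Nat.log 2 m + c₁) ^ c₁) := h2
        _ ≤ 2 ^ ((Nat.log 2 m + max c₁ c₂) ^ max c₁ c₂) :=
            Nat.pow_le_pow_right (by norm_num) (CompressionFloors.polylog_mono (le_max_left _ _))
    · have h1 : (Epw d.val).length = 2 * d.val + 1 := hEpwl d.val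
      have hd : d.val ≤ D m := by have := d.isLt; omega
      have hX : m ^ a + a ≤ 2 ^ ((Nat.log 2 m + (a + 1)) ^ (a + 1)) := CompressionFloors.pbounded_le_qp m a
      have h3 := hc₂ (Nat.log 2 m) (m ^ a + a) 1 hX (by simp)
      have h4 := ha m
      calc (θ m (Sum.inr d)).length = 2 * d.val + 1 := h1
        _ ≤ (m ^ a + a + 2) * (1 + 2) := by omega
        _ ≤ 2 ^ ((Nat.log 2 m + c₂) ^ c₂) := h3
        _ ≤ 2 ^ ((Nat.log 2 m + max c₁ c₂) ^ max c₁ c₂) :=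
            Nat.pow_le_pow_right (by norm_num) (CompressionFloors.polylog_mono (le_max_right _ _))
  -- the substitution engine, sizes decoupled from the family index
  obtain ⟨a, ha⟩ := ((isVQPeFamily_iff_isVQPFamily ℂ (fun m => Fin m ⊕ Fin (D m + 1)) Q).2 hQ).2
  obtain ⟨b, hb⟩ := hθ
  obtain ⟨c, hc⟩ := qp_subst_bound a b
  refine ⟨c, fun m => ?_⟩
  obtain ⟨e, hl, hv⟩ := exists_subst_of_formulaComplexity_le (Q m) (ha m) (θ m) (hb m) Nat.one_le_two_pow
  refine ⟨e, ?_, fun ρ γ => ?_⟩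
  · refine (hl.trans (hc _ _ _ le_rfl le_rfl)).trans (Nat.pow_le_pow_right (by norm_num) ?_)
    exact Nat.pow_le_pow_left (Nat.add_le_add_right (Nat.log_mono_right (Nat.le_succ m)) _) _
  rw [hv]
  -- the value identity on the `(m+1) × (m+1)` matrix
  set punct : Fin m → MvPolynomial (Fin (m + 1) × Fin (m + 1)) ℂ := fun j => X (ρ 0, (γ 0).succAbove j)
    with hpunct
  have hcore : ∀ d : ℕ, aeval (fun j : Fin m => aeval punct (esymm (Fin m) ℂ (j.val + 1))) (P m d) =
      aeval punct (coeffEps d (F m)) := by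
    intro d
    rw [← hP m d, ← AlgHom.comp_apply, comp_aeval]
  have hθv : (fun i => (θ m i).value (m + 1) ρ γ) =
      Sum.elim (fun j : Fin m => aeval punct (esymm (Fin m) ℂ (j.val + 1)))
        (fun d : Fin (D m + 1) => (X (ρ 0, γ 0) : MvPolynomial (Fin (m + 1) × Fin (m + 1)) ℂ) ^ d.val) := by
    funext i
    rcases i with j | d
    · show (E m (j.val + 1)).value (m + 1) ρ γ = _
      rw [(hE m (j.val + 1) (by have := j.isLt; omega)).2]
      rfl
    · show (Epw d.val).value (m + 1) ρ γ = _
      rw [hEpwv]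
      rfl
  rw [hθv]
  show aeval _ (∑ d : Fin (D m + 1), X (Sum.inr d) * rename Sum.inl (P m d.val)) = _
  rw [map_sum]
  have hterm : ∀ d : Fin (D m + 1),
      aeval (Sum.elim (fun j : Fin m => aeval punct (esymm (Fin m) ℂ (j.val + 1)))
        (fun d : Fin (D m + 1) => (X (ρ 0, γ 0) : MvPolynomial (Fin (m + 1) × Fin (m + 1)) ℂ) ^ d.val))
        (X (Sum.inr d) * rename Sum.inl (P m d.val)) =
      (X (ρ 0, γ 0) : MvPolynomial (Fin (m + 1) × Fin (m + 1)) ℂ) ^ d.val * aeval punct (coeffEps d.val (F m)) := by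
    intro d
    rw [map_mul, aeval_X, aeval_rename, Sum.elim_inr]
    congr 1
    rw [← hcore d.val]
    rfl
  simp_rw [hterm]
  conv_rhs => rw [CoefficientSlices.eq_sum_X_pow_mul_rename_coeffEps (F m) (hDt m)]
  rw [map_sum, Finset.sum_range (fun d => aeval _ (X none ^ d * rename some (coeffEps d (F m))))]
  refine Finset.sum_congr rfl fun d _ => ?_
  rw [map_mul, map_pow, aeval_X, aeval_rename]
  rfl

/-- ★ **The 2-row stratum for second-row-affine inner polynomials, canonical (punctured) form.**  For every
`VQP` family `F_m ∈ ℂ[t, z_1, …, z_m]` symmetric in `z`, the matrix-symmetric family on `(m+1) × (m+1)` matrices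
`f = Σ_i Σ_b (Σ_{i'} x_{i'b}) · F_m(x_{ib}; (x_{i, succAbove(b) j})_j) = Σ_{i,i'} g(row i, row i')`,
`g(r, s) = Σ_b s_b F_m(r_b; r_{-b})`, satisfies the conclusion of `stub_narrowExpressionCompression`
(with `(2,1)` labels). [cite: BlaserJindal2019, Thm. 4] -/
theorem narrowQP_twoRow_affine (F : (m : ℕ) → MvPolynomial (Option (Fin m)) ℂ)
    (hsymm : ∀ (m : ℕ) (τ : Equiv.Perm (Fin m)), rename (Option.map τ) (F m) = F m)
    (hF : IsVQPFamily F) :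
    ∃ c : ℕ, ∀ m : ℕ, ∃ (k l : ℕ) (e : PatternExpr ℂ k l),
      (m + 1) ^ (k + l) ≤ 2 ^ ((Nat.log 2 (m + 1) + c) ^ c) ∧ e.length ≤ 2 ^ ((Nat.log 2 (m + 1) + c) ^ c) ∧
      e.close (m + 1) = ∑ i : Fin (m + 1), ∑ b : Fin (m + 1),
        (∑ i' : Fin (m + 1), (X (i', b) : MvPolynomial (Fin (m + 1) × Fin (m + 1)) ℂ)) *
        aeval (fun o : Option (Fin m) => o.elim (X (i, b))
          (fun j => (X (i, b.succAbove j) : MvPolynomial (Fin (m + 1) × Fin (m + 1)) ℂ))) (F m) := by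
  classical
  obtain ⟨c₁, hc₁⟩ := exists_puncturedEntryRowGadget F hsymm hF
  obtain ⟨c₂, hc₂⟩ := NarrowClosure.qp_combine c₁ 0
  refine ⟨max c₂ 4, fun m => ?_⟩
  obtain ⟨W, hWl, hWv⟩ := hc₁ m
  obtain ⟨W', hW'l, hW'v⟩ :=
    NarrowClosure.exists_value_eq_pad (F := ℂ) (k := 1) (l := 1) (K := 2) (L := 1) (by norm_num) le_rfl
      (m + 1) W
  set G : Fin (m + 1) → Fin (m + 1) → MvPolynomial (Fin (m + 1) × Fin (m + 1)) ℂ := fun i b =>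
    aeval (fun o : Option (Fin m) => o.elim (X (i, b))
      (fun j => (X (i, b.succAbove j) : MvPolynomial (Fin (m + 1) × Fin (m + 1)) ℂ))) (F m) with hG
  have hW'G : ∀ (ρ : Fin 2 → Fin (m + 1)) (γ : Fin 1 → Fin (m + 1)), W'.value (m + 1) ρ γ = G (ρ 0) (γ 0) := by
    intro ρ γ
    rw [hW'v, hWv]
    rfl
  set e₁ : PatternExpr ℂ 2 1 :=
    PatternExpr.mul (PatternExpr.sumRow 1 (PatternExpr.edge 1 0)) W' with he₁
  set e₂ : PatternExpr ℂ 2 1 := PatternExpr.sumCol 0 e₁ with he₂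
  set e₃ : PatternExpr ℂ 2 1 := PatternExpr.sumRow 0 e₂ with he₃
  have hv₁ : ∀ (ρ : Fin 2 → Fin (m + 1)) (γ : Fin 1 → Fin (m + 1)), e₁.value (m + 1) ρ γ =
      (∑ i' : Fin (m + 1), (X (i', γ 0) : MvPolynomial (Fin (m + 1) × Fin (m + 1)) ℂ)) * G (ρ 0) (γ 0) := by
    intro ρ γ
    simp only [he₁, PatternExpr.value_mul, PatternExpr.value_sumRow, PatternExpr.value_edge,
      Function.update_self, hW'G]
  have hv₂ : ∀ (ρ : Fin 2 → Fin (m + 1)) (γ : Fin 1 → Fin (m + 1)), e₂.value (m + 1) ρ γ =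
      ∑ b : Fin (m + 1), (∑ i' : Fin (m + 1), (X (i', b) : MvPolynomial (Fin (m + 1) × Fin (m + 1)) ℂ)) *
        G (ρ 0) b := by
    intro ρ γ
    simp only [he₂, PatternExpr.value_sumCol, hv₁, Function.update_self]
  have hv₃ : ∀ (ρ : Fin 2 → Fin (m + 1)) (γ : Fin 1 → Fin (m + 1)), e₃.value (m + 1) ρ γ =
      ∑ i : Fin (m + 1), ∑ b : Fin (m + 1),
        (∑ i' : Fin (m + 1), (X (i', b) : MvPolynomial (Fin (m + 1) × Fin (m + 1)) ℂ)) * G i b := by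
    intro ρ γ
    simp only [he₃, PatternExpr.value_sumRow, hv₂]
    refine Finset.sum_congr rfl fun i _ => ?_
    simp [Function.update_self]
  obtain ⟨e₄, hl₄, hc₄⟩ := exists_close_eq_of_value_const_kl (Nat.succ_pos m) e₃ _ hv₃
  refine ⟨2, 1, e₄, ?_, ?_, by rw [hc₄]⟩
  · calc (m + 1) ^ (2 + 1) ≤ (m + 1) ^ 3 + 3 := by norm_num
      _ ≤ 2 ^ ((Nat.log 2 (m + 1) + 4) ^ 4) := CompressionFloors.pbounded_le_qp (m + 1) 3
      _ ≤ 2 ^ ((Nat.log 2 (m + 1) + max c₂ 4) ^ max c₂ 4) :=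
          Nat.pow_le_pow_right (by norm_num) (CompressionFloors.polylog_mono (le_max_right _ _))
  · have h := hc₂ (Nat.log 2 (m + 1)) W.length 2 hWl (by norm_num)
    calc e₄.length = W.length + 7 := by
          rw [hl₄, he₃, he₂, he₁]; simp [PatternExpr.length, hW'l]; ring
      _ ≤ (W.length + 2) * (2 + 2) := by omega
      _ ≤ 2 ^ ((Nat.log 2 (m + 1) + c₂) ^ c₂) := h
      _ ≤ 2 ^ ((Nat.log 2 (m + 1) + max c₂ 4) ^ max c₂ 4) :=
          Nat.pow_le_pow_right (by norm_num) (CompressionFloors.polylog_mono (le_max_left _ _))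

end FormulaSubstitution

end Summit.ValiantsHypothesis.ValiantsHypothesis.Theorems

end
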